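import Summits.QuantumFields.YangMills.Theorems.BalabanUVNodesK1EndOfNodes13PWSOfRunRemAt
import Summits.QuantumFields.BalabanUV.Gaps.EndRunwiseCone

/-!
# BalabanUVNodes ∕ K1⁷ v6 — ADAPTERS INTO THE REGISTERED RUN ROWS (`stub_runRows13PWS`, plan g82 `D82-K1V6`): the v5 ANNEX made kernel («v5's rung 2 ⟹ v6's rung 2″ at the same
# witness»), the |β|-BOX reduction («at any witness carrying a sign-free |β| box the rows ARE the run-wise partial-sum floor alone»), and the CEILING-KEYED rung-1 bridge (match discharged)

TRACK A (YM-PLAN §2d), node N24 (binder B2, COMPOSITE), WIDTH SEAT `pub-ymgap-dag-n24-w1` (gen 2; director-ym №197 ∕ HUMAN RULING D-0149).  Key of record: K1⁷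
`StabilityBAtRecordR13SepCoPH` = stmt-QuantumFields-20542; `--supports` it AS A HELPER (count-neutral).  Third module of the seat's gen-2 series after `…K1EndOfNodes13PWSOfRunRemAt`
(p598782: the run-letter END road — now the registered composition's engine, K1 v6 `StabilityBAtRecordR13SepCoPH_ofRunRows`) and `…K1EndAtPinX3HSFourPinOfRunRows` (p600421: the pointed ∕
door ∕ 25H twins).  The registered skeleton of record since 03:16:54Z 2026-08-28 is plan g82's `K1Skeleton13SepCoPHv6.lean`: stub 1 `stub_nodes13PWS` (v5 VERBATIM) and stub 2″
`stub_runRows13PWS : ∀ F, NodesAtSomeRecord13PWS F → RunRowsAtSomeRecord13PWS F`, whose rows are DEF-1's run-wise constant remainder `RunConstRemainder β_θ b r γ₀` + `∀ k, b_k ≤ B` +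
the match `B + r ≤ w.βup` + the run-wise (PS) floor `−M` (the letters `(b, r, γ₀, B, M)` ∃-side).  The skeleton's names are SKELETON-LOCAL, so — as every N24 file does — the ∃-texts are
spelled LITERALLY below (`RecordS` ∕ `Window` unfolded).

WHAT IS HERE (theorems only; 0 `def`, 0 `sorry`, standard axioms):
* §1 generic (`β : HBeta`; any forward-generated construction currying `β`): `runConstRemainder_of_twoSided_alongRuns` (a run-wise two-sided bound `lo ≤ β ≤ hi` IS a run-wise constant
  remainder about the midpoint, radius `(hi − lo)∕2`, so `B + r = hi` whatever `lo` is) · `runConstRemainder_of_boxBounds` (box bounds ⟹ the same; in-window prefixes lie in the box) ·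
  `runwisePS_of_lower_alongRuns_nonneg` ∕ `runwisePS_of_betaLowerH_nonneg` (a floor `lo ≥ 0` ⟹ (PS) with `M := 0`) · `runwisePS_mono` (level) · ★ `bounds_alongRGEqH_of_betaBoundsInInterval`
  (v5's INTERVAL binder `DagBinding.BetaBoundsInInterval C γ₀ lo hi` — bounds at the construction's OWN run prefixes with the last slot free — gives the two-sided bound along EVERY solution of
  (0.20) in the window, because such a solution IS the construction's run from its own `g_0` (forward uniqueness `FlowStepRuns.flow_eq_of_rgEqH`, `DagBinding.ForwardGenerated`, the dictionary
  `CurriesHBeta`)).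
* §2 (`N = 2`, skeleton texts VERBATIM): ★ `runRowsAt_of_rung2At` (v5 rung-2 data at `(θ, h, w)` ⊢ v6 rows at the same `(θ, h, w)`: `b :≡ (w.b + w.βup)∕2`, `r := (w.βup − w.b)∕2`, `γ₀ := w.γ`,
  `B + r = w.βup`, `M := 0` from `WorldP.b_pos`) · ★ `stub_runRows13PWS_of_stub_betaWindow13PWS` (v5's STUB-2 TEXT ⟹ v6's STUB-2″ TEXT: the v5 annex of the skeleton made kernel — every
  supplier of the pointwise two-sided road still closes v6) · ★ `runRowsAt_of_rung1At_of_absBox_of_runwisePS` (rung-1 data + a sign-free |β| box `BetaLowerH (−β′) γ₀ ∧ BetaUpperH β′ γ₀`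
  — K0⁷ stub 3ᴬ′'s currency — + `β′ ≤ w.βup` + the run-wise (PS) floor ⊢ v6 rows: AT SUCH A WITNESS STUB 2″ IS THE (PS) FLOOR ALONE) · `runRowsAt_of_rung1At_of_absBox_of_betaPartialSumsLowerH`
  (the same with the floor in the tree's all-history currency `FlowStepRuns.BetaPartialSumsLowerH`, via `Gaps.EndRunwiseCone.runwisePS_of_betaPartialSumsLowerH` BY NAME).
* §3 (`N = 2`) ★ `runRowsText_of_ceilingKeyedRung1_of_rows` — THE CEILING-KEYED BRIDGE (plan g82 WORDS-2 (B) l.28174 «WELCOME as a TREE lemma ∕ bridge»; CRIT-1 g4's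
  K1NEGCTL: nodes are ANTITONE in `w.βup`, so ∀-witness ceiling letters are dead and the live strengthening of rung 1 is «the world keyed AFTER the ceiling»): from the ceiling-keyed
  rung-1 text `∃ θ h, unity ∧ Admissible ∧ ∀ c, ∃ w, c ≤ w.βup ∧ RecordS F θ h w ∧ ∀ P, Nodes (leavesP w P)` (N11 with `β′` a parameter) and the match-FREE run rows of `β_θ`
  (`∃ b r γ₀ B M, 0 < γ₀ ∧ RunConstRemainder β_θ b r γ₀ ∧ (∀ k, b_k ≤ B) ∧` run-wise (PS)) at THAT θ ⊢ v6's rung-2″ text — the match `B + r ≤ w.βup` discharged by choosing the world at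
  `c := B + r`.  (The 25H-type closing twins with run rows live in p600421 §4; dag-n24-c's Part 24 BUILDS the world with `βup := B + r` — the same discharge, pointed.)

HONEST SCOPE ∕ A6.  Implications ∕ adapters only; every letter (interval binder, box, (PS) floor, rung data, ceiling-keyed rung-1 text) is DISPLAYED and inhabited at NO θ here
(«not exhibited», №167).  v6's stub 2″ is NOT proved: its (PS) floor at the record is [Balaban1988RG2Cluster] (2.41)-class content, printed as no theorem of the series (T09.F, lower
half).  Nothing of Bałaban asserted; K0⁷ ∕ K1⁷ NOT closed; N24 COMPOSITE — no discharge, no count claim (typed 28∕28 · discharged 5∕27 unmoved).  One finite 𝕋⁴ programme at fixed ε,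
Bałaban AS PRINTED; R4 closes ONLY the conditional finite-𝕋⁴ rung `BalabanLadder.UV` — the YM mass gap (Clay) is NOT proved by any of this; nothing continuum ∕ ℝ⁴ ∕ OS.  Theorems only:
no `def`, no `instance`, no `sorry`, standard axioms.  References (context; nothing printed is used as a hypothesis): [I] = [Balaban1987RG1] CMP **109**: (0.17)–(0.20) pp.255–256, Thm 2
p.259, (1.20)–(1.22) p.264, Thm 3 p.264, (5.10) p.293; [II] = [Balaban1988RG2Cluster] CMP **116**: (2.41) p.21; [III] = [Balaban1988Convergent] CMP **119**: (2.6) p.255, Cor. 3 (2.50)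
p.264; [V] = [Balaban1989LargeFieldII] CMP **122**: Thm 1 + (0.1) pp.355–356, p.391.
-/

noncomputable section

open scoped Matrix.Norms.L2Operator

namespace Summit.QuantumFields.YangMills.BalabanUVNodes.K1RunRowsOfBoxAndPartialSums

open Literature.MathematicalPhysics.QuantumFieldTheory.Balaban1983to89
open Literature.MathematicalPhysics.QuantumFieldTheory.Balaban1983to89.Node00
open DagBinding T4Continuum T4DatumAssembly FlowStepRuns AveragingRT
open FlowStep (HBeta RGEqH prefixOf BetaLowerH BetaUpperH mem_box)
open Summit.QuantumFields.YangMills.Theorems.BalabanUVNodesK2NamedJetsRunRemAt (RunConstRemainder)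
open Summit.QuantumFields.BalabanUV.Gaps.EndRunwiseCone (runwisePS_of_betaPartialSumsLowerH)

/-! ## §1. Generic adapters into the run-rows letters -/

section Generic

variable {β : HBeta}

/-- **A RUN-WISE TWO-SIDED BOUND IS A RUN-WISE CONSTANT REMAINDER ABOUT THE MIDPOINT**: `lo ≤ β_k(g_0,…,g_k) ≤ hi` along every (0.20)-solution in `]0, γ₀]` gives
`RunConstRemainder β (k ↦ (lo+hi)∕2) ((hi−lo)∕2) γ₀` — so in v6's rows `B := (lo+hi)∕2` and `B + r = hi`: the LOWER end `lo` is free (any real), only the ceiling enters the match.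
[cite: Balaban1987RG1, Thm 3 p.264 and (1.20)–(1.22) p.264 (bookkeeping)] -/
theorem runConstRemainder_of_twoSided_alongRuns {lo hi γ₀ : ℝ}
    (h : ∀ (n : ℕ) (gs : ℕ → ℝ), RGEqH n β gs → Step.InInterval γ₀ n gs → ∀ k, k ≤ n → lo ≤ β k (prefixOf gs k) ∧ β k (prefixOf gs k) ≤ hi) :
    RunConstRemainder β (fun _ => (lo + hi) / 2) ((hi - lo) / 2) γ₀ := by
  intro n gs hrg hI k hk
  obtain ⟨h1, h2⟩ := h n gs hrg hI k hk
  rw [abs_le]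
  constructor <;> linarith

/-- **BOX BOUNDS ⟹ THE RUN-WISE CONSTANT REMAINDER** (in-window prefixes lie in the box `]0, γ₀]^{k+1}`). [cite: Balaban1987RG1, §1 (1.22) p.264 (bookkeeping)] -/
theorem runConstRemainder_of_boxBounds {lo hi γ₀ : ℝ} (hlo : BetaLowerH lo γ₀ β) (hhi : BetaUpperH hi γ₀ β) :
    RunConstRemainder β (fun _ => (lo + hi) / 2) ((hi - lo) / 2) γ₀ :=
  runConstRemainder_of_twoSided_alongRuns fun _ gs _ hI k hk =>
    have hv : prefixOf gs k ∈ FlowStep.Box γ₀ k :=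
      mem_box.mpr fun i => hI i ((Nat.lt_succ_iff.mp i.isLt).trans hk)
    ⟨hlo k _ hv, hhi k _ hv⟩

/-- **A NON-NEGATIVE RUN-WISE FLOOR ⟹ THE RUN-WISE (PS) LETTER WITH `M := 0`.** [cite: Balaban1987RG1, Thm 2 p.259 (first sentence) (bookkeeping)] -/
theorem runwisePS_of_lower_alongRuns_nonneg {lo γ₀ : ℝ} (hlo0 : 0 ≤ lo)
    (h : ∀ (n : ℕ) (gs : ℕ → ℝ), RGEqH n β gs → Step.InInterval γ₀ n gs → ∀ k, k ≤ n → lo ≤ β k (prefixOf gs k)) :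
    ∀ (n : ℕ) (gs : ℕ → ℝ), RGEqH n β gs → Step.InInterval γ₀ n gs → ∀ k, k ≤ n → -(0 : ℝ) ≤ ∑ i ∈ Finset.Ico k n, β i (prefixOf gs i) := by
  intro n gs hrg hI k hk
  rw [neg_zero]
  exact Finset.sum_nonneg fun i hi => hlo0.trans (h n gs hrg hI i (Finset.mem_Ico.mp hi).2.le)

/-- … in particular from a box floor `BetaLowerH lo γ₀ β` with `0 ≤ lo` (the SIGN, or v5's positive floor). [cite: Balaban1987RG1, Thm 2 p.259 and §1 p.264 (bookkeeping)] -/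
theorem runwisePS_of_betaLowerH_nonneg {lo γ₀ : ℝ} (hlo0 : 0 ≤ lo) (hlo : BetaLowerH lo γ₀ β) :
    ∀ (n : ℕ) (gs : ℕ → ℝ), RGEqH n β gs → Step.InInterval γ₀ n gs → ∀ k, k ≤ n → -(0 : ℝ) ≤ ∑ i ∈ Finset.Ico k n, β i (prefixOf gs i) :=
  runwisePS_of_lower_alongRuns_nonneg hlo0 fun _ _ _ hI k hk =>
    hlo k _ (mem_box.mpr fun i => hI i ((Nat.lt_succ_iff.mp i.isLt).trans hk))

/-- The run-wise (PS) letter is antitone in the level: runs in `]0, γ₁]`, `γ₁ ≤ γ₀`, are runs in `]0, γ₀]`. [cite: Balaban1987RG1, Thm 2 p.259 (bookkeeping)] -/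
theorem runwisePS_mono {M γ₀ γ₁ : ℝ} (hle : γ₁ ≤ γ₀)
    (h : ∀ (n : ℕ) (gs : ℕ → ℝ), RGEqH n β gs → Step.InInterval γ₀ n gs → ∀ k, k ≤ n → -M ≤ ∑ i ∈ Finset.Ico k n, β i (prefixOf gs i)) :
    ∀ (n : ℕ) (gs : ℕ → ℝ), RGEqH n β gs → Step.InInterval γ₁ n gs → ∀ k, k ≤ n → -M ≤ ∑ i ∈ Finset.Ico k n, β i (prefixOf gs i) :=
  fun n gs hrg hI => h n gs hrg fun j hj => ⟨(hI j hj).1, (hI j hj).2.trans hle⟩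

/-- **★ v5's INTERVAL BINDER READ ALONG EVERY (0.20)-SOLUTION.**  For a construction `C` forward-generated by `β` (`ForwardGenerated`) whose run-wise β-functions curry `β` (`CurriesHBeta`):
`BetaBoundsInInterval C γ₀ lo hi` — the bounds `lo ≤ β_{j+1}(x) ≤ hi` at the construction's OWN run prefixes `(g_0,…,g_{j−1})` in the window with the last slot `x ∈ ]0, γ₀]` free
([Balaban1987RG1] (1.22) p.264 in its faithful typed form) — gives `lo ≤ β k (g_0,…,g_k) ≤ hi` along EVERY solution `gs` of (0.20) up to `n` staying in `]0, γ₀]`, `k ≤ n`: the run of `C`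
with parameters `(k+1, m, gs 0)` agrees with `gs` up to `k` (forward uniqueness `FlowStepRuns.flow_eq_of_rgEqH`), its step `j := k < k+1` has its earlier couplings in the window, and
`β_{k+1}(gs k)` there IS `β k (gs_0,…,gs_k)` (dictionary + `update_prefixOf_last`).  `m` is any torus exponent (the flow clauses hold at every `P`).
[cite: Balaban1987RG1, (0.17)–(0.20) pp.255–256, §1 (1.22) p.264, Thm 3 p.264 (bookkeeping)] -/
theorem bounds_alongRGEqH_of_betaBoundsInInterval (C : B12.Construction) (β : HBeta) (hgen : ForwardGenerated C β) (hcur : CurriesHBeta C β)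
    {γ₀ lo hi : ℝ} (hβ : BetaBoundsInInterval C γ₀ lo hi) (m : ℕ) :
    ∀ (n : ℕ) (gs : ℕ → ℝ), RGEqH n β gs → Step.InInterval γ₀ n gs → ∀ k, k ≤ n → lo ≤ β k (prefixOf gs k) ∧ β k (prefixOf gs k) ≤ hi := by
  intro n gs hrg hI k hk
  have hpos : ∀ i, i ≤ k → 0 < gs i := fun i hi => (hI i (hi.trans hk)).1
  have hKlt : k < (⟨k + 1, m, gs 0⟩ : B12.RunParams).K := Nat.lt_succ_self k
  have hagree : ∀ i, i ≤ k → (C ⟨k + 1, m, gs 0⟩).flow.g i = gs i :=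
    flow_eq_of_rgEqH (C ⟨k + 1, m, gs 0⟩).flow β k
      (fun k' hk' hposk hrhs => hgen.2 ⟨k + 1, m, gs 0⟩ k' (Nat.lt_succ_of_lt hk') hposk hrhs)
      (hgen.1 ⟨k + 1, m, gs 0⟩) (fun j hj => hrg j (lt_of_lt_of_le hj hk)) hpos
  have hist : ∀ i, i < k → 0 < (C ⟨k + 1, m, gs 0⟩).flow.g i ∧ (C ⟨k + 1, m, gs 0⟩).flow.g i ≤ γ₀ := fun i hi => by
    rw [hagree i hi.le]; exact hI i (hi.le.trans hk)
  have hb := hβ ⟨k + 1, m, gs 0⟩ k (gs k) hKlt hist (hI k hk).1 (hI k hk).2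
  have hpre : prefixOf (C ⟨k + 1, m, gs 0⟩).flow.g k = prefixOf gs k := by
    funext i
    simp only [FlowStep.prefixOf_apply]
    exact hagree i (Nat.lt_succ_iff.mp i.isLt)
  rw [hcur ⟨k + 1, m, gs 0⟩ k _ hKlt, hpre, update_prefixOf_last] at hb
  exact hb

end Generic

/-! ## §2. `N = 2`: v5's rung 2 ⟹ v6's rung 2″ at the same witness; the |β|-box reduction of the rows to the (PS) floor -/

section Skeleton

variable {F : T4Family}

/-- **★ v5 RUNG-2 DATA AT `(θ, h, w)` ⟹ v6 RUN ROWS AT THE SAME `(θ, h, w)`** (the skeleton's v5 annex made kernel, pointwise).  From plan's `RecordS F θ h w` (spelled out), the thirteen nodes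
at every run and v5's interval binder `BetaBoundsInInterval w.C.toB12 w.γ w.b w.βup` (floor `w.b > 0` = `WorldP.b_pos`): v6's rung-2″ ∃-text, witnessed at the SAME `(θ, h, w)` with
`b :≡ (w.b + w.βup)∕2`, `r := (w.βup − w.b)∕2`, `γ₀ := w.γ`, `B := (w.b + w.βup)∕2` (so `B + r = w.βup`), `M := 0`.  Road: `w.C = D.C` from `RecordS`; §1's
`bounds_alongRGEqH_of_betaBoundsInInterval` at `D.fwd ∕ D.curries` (`D :=` the datum; `D.βfun = betaOfRecord₁₃ θ`, `rfl`); midpoint remainder; (PS) with `M = 0` from the positive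
floor.  CONDITIONAL; closes nothing. [cite: Balaban1987RG1, (0.17)–(0.20) pp.255–256, §1 (1.22) p.264, Thm 3 p.264; Balaban1989LargeFieldII, Thm 1 p.355 (bookkeeping)] -/
theorem runRowsAt_of_rung2At (θ : Stage13HParams F 2) (h : θ.Provisos₁₃SepCoPH F 2) (w : WorldP)
    (hU : θ.ZhUnity F 2 ∧ θ.SlotsNondegenerate₁₃ F 2) (hθ : θ.Admissible F 2)
    (hR : ∃ (θ' : Stage13HParams F 2) (h' : θ'.Provisos₁₃SepCoPH F 2), θ'.Admissible F 2 ∧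
      datumOfRecord₁₃SepCoPH F 2 θ h = datumOfRecord₁₃SepCoPH F 2 θ' h' ∧ w.C = (datumOfRecord₁₃SepCoPH F 2 θ h).C ∧ (0 < w.γ ∧ w.γ ≤ θ'.γ) ∧
      w.L = (θ'.L : ℝ) ∧ ∀ P : B12.RunParams, w.up P = upOfRecord₅CS F 2 (θ'.toStage5₁₃CoPH F 2) P)
    (hnodes : ∀ P : B12.RunParams, Nodes (leavesP w P)) (hβ : BetaBoundsInInterval w.C.toB12 w.γ w.b w.βup) :
    ∃ (θ : Stage13HParams F 2) (h : θ.Provisos₁₃SepCoPH F 2) (w : WorldP), (θ.ZhUnity F 2 ∧ θ.SlotsNondegenerate₁₃ F 2) ∧ θ.Admissible F 2 ∧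
      (∃ (θ' : Stage13HParams F 2) (h' : θ'.Provisos₁₃SepCoPH F 2), θ'.Admissible F 2 ∧
        datumOfRecord₁₃SepCoPH F 2 θ h = datumOfRecord₁₃SepCoPH F 2 θ' h' ∧ w.C = (datumOfRecord₁₃SepCoPH F 2 θ h).C ∧ (0 < w.γ ∧ w.γ ≤ θ'.γ) ∧
        w.L = (θ'.L : ℝ) ∧ ∀ P : B12.RunParams, w.up P = upOfRecord₅CS F 2 (θ'.toStage5₁₃CoPH F 2) P) ∧
      (∀ P : B12.RunParams, Nodes (leavesP w P)) ∧
      ∃ (b : ℕ → ℝ) (r γ₀ B M : ℝ), 0 < γ₀ ∧ RunConstRemainder (betaOfRecord₁₃ F 2 θ.toStage13Params) b r γ₀ ∧ (∀ k, b k ≤ B) ∧ B + r ≤ w.βup ∧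
        ∀ (n : ℕ) (gs : ℕ → ℝ), RGEqH n (betaOfRecord₁₃ F 2 θ.toStage13Params) gs → Step.InInterval γ₀ n gs →
          ∀ k, k ≤ n → -M ≤ ∑ j ∈ Finset.Ico k n, betaOfRecord₁₃ F 2 θ.toStage13Params j (prefixOf gs j) := by
  obtain ⟨θ', h', hθ', hD, hC, hγ, hL, hup⟩ := hR
  have hβ' : BetaBoundsInInterval (datumOfRecord₁₃SepCoPH F 2 θ h).C.toB12 w.γ w.b w.βup := by
    have e : (datumOfRecord₁₃SepCoPH F 2 θ h).C.toB12 = w.C.toB12 := by rw [hC]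
    rw [e]; exact hβ
  have hb2 := bounds_alongRGEqH_of_betaBoundsInInterval (datumOfRecord₁₃SepCoPH F 2 θ h).C.toB12 (betaOfRecord₁₃ F 2 θ.toStage13Params)
    (datumOfRecord₁₃SepCoPH F 2 θ h).fwd (datumOfRecord₁₃SepCoPH F 2 θ h).curries hβ' F.m
  refine ⟨θ, h, w, hU, hθ, ⟨θ', h', hθ', hD, hC, hγ, hL, hup⟩, hnodes, fun _ => (w.b + w.βup) / 2, (w.βup - w.b) / 2, w.γ, (w.b + w.βup) / 2, 0, hγ.1,
    runConstRemainder_of_twoSided_alongRuns hb2, fun _ => le_rfl, le_of_eq (by ring), ?_⟩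
  exact runwisePS_of_lower_alongRuns_nonneg w.b_pos.le fun n gs hrg hI k hk => (hb2 n gs hrg hI k hk).1

/-- **★ v5's STUB-2 TEXT ⟹ v6's STUB-2″ TEXT** (`N = 2`, both texts VERBATIM with `RecordS` ∕ `Window` unfolded): every supplier of the pointwise two-sided road of record (v5's
`stub_betaWindow13PWS : ∀ F, NodesAtSomeRecord13PWS F → BetaWindowAtSomeRecord13S F`) still closes the registered v6 stub `stub_runRows13PWS : ∀ F, NodesAtSomeRecord13PWS F → RunRowsAtSomeRecord13PWS F`
— the v6 rows are WEAKER than the v5 binder (the window conjunct is simply dropped: on the v6 road it is derived).  Hypothesis-form; closes nothing by itself.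
[cite: Balaban1987RG1, §1 (1.22) p.264, Thm 3 p.264; Balaban1989LargeFieldII, Thm 1 p.355 (bookkeeping)] -/
theorem stub_runRows13PWS_of_stub_betaWindow13PWS
    (h₂ : ∀ F : T4Family,
      (∃ (θ : Stage13HParams F 2) (h : θ.Provisos₁₃SepCoPH F 2) (w : WorldP), (θ.ZhUnity F 2 ∧ θ.SlotsNondegenerate₁₃ F 2) ∧ θ.Admissible F 2 ∧
        (∃ (θ' : Stage13HParams F 2) (h' : θ'.Provisos₁₃SepCoPH F 2), θ'.Admissible F 2 ∧
          datumOfRecord₁₃SepCoPH F 2 θ h = datumOfRecord₁₃SepCoPH F 2 θ' h' ∧ w.C = (datumOfRecord₁₃SepCoPH F 2 θ h).C ∧ (0 < w.γ ∧ w.γ ≤ θ'.γ) ∧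
          w.L = (θ'.L : ℝ) ∧ ∀ P : B12.RunParams, w.up P = upOfRecord₅CS F 2 (θ'.toStage5₁₃CoPH F 2) P) ∧
        (∀ P : B12.RunParams, Nodes (leavesP w P)) ∧ PrintedUV3V 2 θ.L ∧
        ∃ lam : ResidW F 2, (∀ P : B12.RunParams, 1 ≤ P.K → lam.kSel P < P.K) ∧
          ∀ P : B12.RunParams, lam.kSel P < P.K → ((leavesP w P).rBasicStep ↔ B15Leaf (WOfRecord₁₃ F 2 θ.toStage13Params lam P))) →
      ∃ (θ : Stage13HParams F 2) (h : θ.Provisos₁₃SepCoPH F 2) (w : WorldP), (θ.ZhUnity F 2 ∧ θ.SlotsNondegenerate₁₃ F 2) ∧ θ.Admissible F 2 ∧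
        (∃ (θ' : Stage13HParams F 2) (h' : θ'.Provisos₁₃SepCoPH F 2), θ'.Admissible F 2 ∧
          datumOfRecord₁₃SepCoPH F 2 θ h = datumOfRecord₁₃SepCoPH F 2 θ' h' ∧ w.C = (datumOfRecord₁₃SepCoPH F 2 θ h).C ∧ (0 < w.γ ∧ w.γ ≤ θ'.γ) ∧
          w.L = (θ'.L : ℝ) ∧ ∀ P : B12.RunParams, w.up P = upOfRecord₅CS F 2 (θ'.toStage5₁₃CoPH F 2) P) ∧
        (∀ P : B12.RunParams, Nodes (leavesP w P)) ∧
        BetaBoundsInInterval w.C.toB12 w.γ w.b w.βup ∧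
        ∃ γ₁ : ℝ, 0 < γ₁ ∧ ∀ γ : ℝ, 0 < γ → γ ≤ γ₁ → ∃ P : B12.RunParams, 1 ≤ P.K ∧ ((datumOfRecord₁₃SepCoPH F 2 θ h).C P).flow.InInterval γ P.K) :
    ∀ F : T4Family,
      (∃ (θ : Stage13HParams F 2) (h : θ.Provisos₁₃SepCoPH F 2) (w : WorldP), (θ.ZhUnity F 2 ∧ θ.SlotsNondegenerate₁₃ F 2) ∧ θ.Admissible F 2 ∧
        (∃ (θ' : Stage13HParams F 2) (h' : θ'.Provisos₁₃SepCoPH F 2), θ'.Admissible F 2 ∧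
          datumOfRecord₁₃SepCoPH F 2 θ h = datumOfRecord₁₃SepCoPH F 2 θ' h' ∧ w.C = (datumOfRecord₁₃SepCoPH F 2 θ h).C ∧ (0 < w.γ ∧ w.γ ≤ θ'.γ) ∧
          w.L = (θ'.L : ℝ) ∧ ∀ P : B12.RunParams, w.up P = upOfRecord₅CS F 2 (θ'.toStage5₁₃CoPH F 2) P) ∧
        (∀ P : B12.RunParams, Nodes (leavesP w P)) ∧ PrintedUV3V 2 θ.L ∧
        ∃ lam : ResidW F 2, (∀ P : B12.RunParams, 1 ≤ P.K → lam.kSel P < P.K) ∧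
          ∀ P : B12.RunParams, lam.kSel P < P.K → ((leavesP w P).rBasicStep ↔ B15Leaf (WOfRecord₁₃ F 2 θ.toStage13Params lam P))) →
      ∃ (θ : Stage13HParams F 2) (h : θ.Provisos₁₃SepCoPH F 2) (w : WorldP), (θ.ZhUnity F 2 ∧ θ.SlotsNondegenerate₁₃ F 2) ∧ θ.Admissible F 2 ∧
        (∃ (θ' : Stage13HParams F 2) (h' : θ'.Provisos₁₃SepCoPH F 2), θ'.Admissible F 2 ∧
          datumOfRecord₁₃SepCoPH F 2 θ h = datumOfRecord₁₃SepCoPH F 2 θ' h' ∧ w.C = (datumOfRecord₁₃SepCoPH F 2 θ h).C ∧ (0 < w.γ ∧ w.γ ≤ θ'.γ) ∧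
          w.L = (θ'.L : ℝ) ∧ ∀ P : B12.RunParams, w.up P = upOfRecord₅CS F 2 (θ'.toStage5₁₃CoPH F 2) P) ∧
        (∀ P : B12.RunParams, Nodes (leavesP w P)) ∧
        ∃ (b : ℕ → ℝ) (r γ₀ B M : ℝ), 0 < γ₀ ∧ RunConstRemainder (betaOfRecord₁₃ F 2 θ.toStage13Params) b r γ₀ ∧ (∀ k, b k ≤ B) ∧ B + r ≤ w.βup ∧
          ∀ (n : ℕ) (gs : ℕ → ℝ), RGEqH n (betaOfRecord₁₃ F 2 θ.toStage13Params) gs → Step.InInterval γ₀ n gs →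
            ∀ k, k ≤ n → -M ≤ ∑ j ∈ Finset.Ico k n, betaOfRecord₁₃ F 2 θ.toStage13Params j (prefixOf gs j) := by
  intro F h₁
  obtain ⟨θ, h, w, hU, hθ, hR, hnodes, hβ, -⟩ := h₂ F h₁
  exact runRowsAt_of_rung2At θ h w hU hθ hR hnodes hβ

/-- **★ AT A WITNESS CARRYING A SIGN-FREE |β| BOX, v6's ROWS ARE THE RUN-WISE (PS) FLOOR ALONE.**  Rung-1 data at `(θ, h, w)` + a box `BetaLowerH (−β′) γ₀ β_θ ∧ BetaUpperH β′ γ₀ β_θ`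
(K0⁷ stub 3ᴬ′'s currency `AbsBetaBoxAtThm1WitnessCCMGenAt`: [Balaban1987RG1] §1 p.264 ∕ Thm 2 «uniformly bounded», NO SIGN) + the match `β′ ≤ w.βup` + the run-wise (PS) floor with defect
`M` on the same level ⊢ v6's rung-2″ ∃-text at `(θ, h, w)` (`b :≡ 0`, `r := β′`, `B := 0`).  So, given 3ᴬ′ and a world built with `w.βup ≥ β′` (as dag-n24-c's closers do), the registered stub 2″
asks at that witness EXACTLY «partial sums of `β_θ` along in-window (0.20)-runs bounded below» — [Balaban1988RG2Cluster] (2.41)-class content — and nothing else.  CONDITIONAL; closes nothing.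
[cite: Balaban1987RG1, §1 (1.22) p.264, Thm 2 p.259, Thm 3 p.264; Balaban1988RG2Cluster, (2.41) p.21 (bookkeeping)] -/
theorem runRowsAt_of_rung1At_of_absBox_of_runwisePS (θ : Stage13HParams F 2) (h : θ.Provisos₁₃SepCoPH F 2) (w : WorldP)
    (hU : θ.ZhUnity F 2 ∧ θ.SlotsNondegenerate₁₃ F 2) (hθ : θ.Admissible F 2)
    (hR : ∃ (θ' : Stage13HParams F 2) (h' : θ'.Provisos₁₃SepCoPH F 2), θ'.Admissible F 2 ∧
      datumOfRecord₁₃SepCoPH F 2 θ h = datumOfRecord₁₃SepCoPH F 2 θ' h' ∧ w.C = (datumOfRecord₁₃SepCoPH F 2 θ h).C ∧ (0 < w.γ ∧ w.γ ≤ θ'.γ) ∧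
      w.L = (θ'.L : ℝ) ∧ ∀ P : B12.RunParams, w.up P = upOfRecord₅CS F 2 (θ'.toStage5₁₃CoPH F 2) P)
    (hnodes : ∀ P : B12.RunParams, Nodes (leavesP w P))
    {γ₀ β' M : ℝ} (hγ₀ : 0 < γ₀) (hlow : BetaLowerH (-β') γ₀ (betaOfRecord₁₃ F 2 θ.toStage13Params)) (hup : BetaUpperH β' γ₀ (betaOfRecord₁₃ F 2 θ.toStage13Params))
    (hmatch : β' ≤ w.βup)
    (hps : ∀ (n : ℕ) (gs : ℕ → ℝ), RGEqH n (betaOfRecord₁₃ F 2 θ.toStage13Params) gs → Step.InInterval γ₀ n gs →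
      ∀ k, k ≤ n → -M ≤ ∑ j ∈ Finset.Ico k n, betaOfRecord₁₃ F 2 θ.toStage13Params j (prefixOf gs j)) :
    ∃ (θ : Stage13HParams F 2) (h : θ.Provisos₁₃SepCoPH F 2) (w : WorldP), (θ.ZhUnity F 2 ∧ θ.SlotsNondegenerate₁₃ F 2) ∧ θ.Admissible F 2 ∧
      (∃ (θ' : Stage13HParams F 2) (h' : θ'.Provisos₁₃SepCoPH F 2), θ'.Admissible F 2 ∧
        datumOfRecord₁₃SepCoPH F 2 θ h = datumOfRecord₁₃SepCoPH F 2 θ' h' ∧ w.C = (datumOfRecord₁₃SepCoPH F 2 θ h).C ∧ (0 < w.γ ∧ w.γ ≤ θ'.γ) ∧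
        w.L = (θ'.L : ℝ) ∧ ∀ P : B12.RunParams, w.up P = upOfRecord₅CS F 2 (θ'.toStage5₁₃CoPH F 2) P) ∧
      (∀ P : B12.RunParams, Nodes (leavesP w P)) ∧
      ∃ (b : ℕ → ℝ) (r γ₀ B M : ℝ), 0 < γ₀ ∧ RunConstRemainder (betaOfRecord₁₃ F 2 θ.toStage13Params) b r γ₀ ∧ (∀ k, b k ≤ B) ∧ B + r ≤ w.βup ∧
        ∀ (n : ℕ) (gs : ℕ → ℝ), RGEqH n (betaOfRecord₁₃ F 2 θ.toStage13Params) gs → Step.InInterval γ₀ n gs →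
          ∀ k, k ≤ n → -M ≤ ∑ j ∈ Finset.Ico k n, betaOfRecord₁₃ F 2 θ.toStage13Params j (prefixOf gs j) := by
  have hrem := runConstRemainder_of_boxBounds hlow hup
  have e1 : (-β' + β') / 2 = (0 : ℝ) := by ring
  have e2 : (β' - -β') / 2 = β' := by ring
  rw [e1, e2] at hrem
  exact ⟨θ, h, w, hU, hθ, hR, hnodes, fun _ => 0, β', γ₀, 0, M, hγ₀, hrem, fun _ => le_rfl, by linarith, hps⟩

/-- **… the same with the (PS) floor in the TREE's ALL-HISTORY currency** `FlowStepRuns.BetaPartialSumsLowerH M γ₀ β_θ` (the Gaps lane's ∕ g0's E-road letter, p588006 §4; K2⁷'s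
old endpoint currency): it implies the run-wise (PS) by `Gaps.EndRunwiseCone.runwisePS_of_betaPartialSumsLowerH` BY NAME, so «|β| box + box partial sums + `β′ ≤ w.βup`» at a rung-1
witness also gives v6's rows.  CONDITIONAL; closes nothing. [cite: Balaban1987RG1, Thm 2 p.259 (first sentence), §1 (1.22) p.264 (bookkeeping)] -/
theorem runRowsAt_of_rung1At_of_absBox_of_betaPartialSumsLowerH (θ : Stage13HParams F 2) (h : θ.Provisos₁₃SepCoPH F 2) (w : WorldP)
    (hU : θ.ZhUnity F 2 ∧ θ.SlotsNondegenerate₁₃ F 2) (hθ : θ.Admissible F 2)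
    (hR : ∃ (θ' : Stage13HParams F 2) (h' : θ'.Provisos₁₃SepCoPH F 2), θ'.Admissible F 2 ∧
      datumOfRecord₁₃SepCoPH F 2 θ h = datumOfRecord₁₃SepCoPH F 2 θ' h' ∧ w.C = (datumOfRecord₁₃SepCoPH F 2 θ h).C ∧ (0 < w.γ ∧ w.γ ≤ θ'.γ) ∧
      w.L = (θ'.L : ℝ) ∧ ∀ P : B12.RunParams, w.up P = upOfRecord₅CS F 2 (θ'.toStage5₁₃CoPH F 2) P)
    (hnodes : ∀ P : B12.RunParams, Nodes (leavesP w P))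
    {γ₀ β' M : ℝ} (hγ₀ : 0 < γ₀) (hlow : BetaLowerH (-β') γ₀ (betaOfRecord₁₃ F 2 θ.toStage13Params)) (hup : BetaUpperH β' γ₀ (betaOfRecord₁₃ F 2 θ.toStage13Params))
    (hmatch : β' ≤ w.βup) (hps : BetaPartialSumsLowerH M γ₀ (betaOfRecord₁₃ F 2 θ.toStage13Params)) :
    ∃ (θ : Stage13HParams F 2) (h : θ.Provisos₁₃SepCoPH F 2) (w : WorldP), (θ.ZhUnity F 2 ∧ θ.SlotsNondegenerate₁₃ F 2) ∧ θ.Admissible F 2 ∧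
      (∃ (θ' : Stage13HParams F 2) (h' : θ'.Provisos₁₃SepCoPH F 2), θ'.Admissible F 2 ∧
        datumOfRecord₁₃SepCoPH F 2 θ h = datumOfRecord₁₃SepCoPH F 2 θ' h' ∧ w.C = (datumOfRecord₁₃SepCoPH F 2 θ h).C ∧ (0 < w.γ ∧ w.γ ≤ θ'.γ) ∧
        w.L = (θ'.L : ℝ) ∧ ∀ P : B12.RunParams, w.up P = upOfRecord₅CS F 2 (θ'.toStage5₁₃CoPH F 2) P) ∧
      (∀ P : B12.RunParams, Nodes (leavesP w P)) ∧
      ∃ (b : ℕ → ℝ) (r γ₀ B M : ℝ), 0 < γ₀ ∧ RunConstRemainder (betaOfRecord₁₃ F 2 θ.toStage13Params) b r γ₀ ∧ (∀ k, b k ≤ B) ∧ B + r ≤ w.βup ∧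
        ∀ (n : ℕ) (gs : ℕ → ℝ), RGEqH n (betaOfRecord₁₃ F 2 θ.toStage13Params) gs → Step.InInterval γ₀ n gs →
          ∀ k, k ≤ n → -M ≤ ∑ j ∈ Finset.Ico k n, betaOfRecord₁₃ F 2 θ.toStage13Params j (prefixOf gs j) :=
  runRowsAt_of_rung1At_of_absBox_of_runwisePS θ h w hU hθ hR hnodes hγ₀ hlow hup hmatch (runwisePS_of_betaPartialSumsLowerH hγ₀ hps)

end Skeleton

/-! ## §3. `N = 2`: the CEILING-KEYED rung-1 bridge — the match discharged by choosing the world after the rows -/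

section CeilingKeyed

variable {F : T4Family}

/-- **★ THE CEILING-KEYED BRIDGE INTO v6's RUN ROWS** (plan g82 WORDS-2 (B): «the ceiling-keyed strengthening `∃ θ h, … ∧ ∀ c, ∃ w, c ≤ w.βup ∧ RecordS F θ h w ∧ ∀ P, Nodes (leavesP w P)`
(N11 with β′ a parameter) is WELCOME as a TREE lemma ∕ bridge»; CRIT-1 g4 K1NEGCTL: the thirteen nodes are ANTITONE in `w.βup`, so a ceiling letter quantified over ALL rung-1 witnesses is
inconsistent with one witness — the live form keys the world AFTER the ceiling).  From the ceiling-keyed rung-1 data at one unity tuple `(θ, h)` and the MATCH-FREE run rows of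
`β_θ := betaOfRecord₁₃ F 2 θ.toStage13Params` (`RunConstRemainder β_θ b r γ₀`, `∀ k, b_k ≤ B`, run-wise (PS) `−M`; NO ceiling clause): v6's rung-2″ ∃-text (`RecordS` unfolded) — the world
chosen at `c := B + r`, so `B + r ≤ w.βup` holds by the family's own clause.  Whether rung-1 worlds ARE ceiling-keyed is the rung-1 lanes' question (N11's `h11` with `β′` a parameter —
dag-n12-d ANSWER-CEILING), NOT claimed.  CONDITIONAL; closes nothing.
[cite: Balaban1987RG1, Thm 3 p.264, (1.20)–(1.22) p.264, (5.10) p.293; Balaban1988Convergent, (2.6) p.255; Balaban1989LargeFieldII, Thm 1 p.355 (bookkeeping)] -/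
theorem runRowsText_of_ceilingKeyedRung1_of_rows (θ : Stage13HParams F 2) (h : θ.Provisos₁₃SepCoPH F 2)
    (hU : θ.ZhUnity F 2 ∧ θ.SlotsNondegenerate₁₃ F 2) (hθ : θ.Admissible F 2)
    (hfam : ∀ c : ℝ, ∃ w : WorldP, c ≤ w.βup ∧
      (∃ (θ' : Stage13HParams F 2) (h' : θ'.Provisos₁₃SepCoPH F 2), θ'.Admissible F 2 ∧
        datumOfRecord₁₃SepCoPH F 2 θ h = datumOfRecord₁₃SepCoPH F 2 θ' h' ∧ w.C = (datumOfRecord₁₃SepCoPH F 2 θ h).C ∧ (0 < w.γ ∧ w.γ ≤ θ'.γ) ∧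
        w.L = (θ'.L : ℝ) ∧ ∀ P : B12.RunParams, w.up P = upOfRecord₅CS F 2 (θ'.toStage5₁₃CoPH F 2) P) ∧
      (∀ P : B12.RunParams, Nodes (leavesP w P)))
    {b : ℕ → ℝ} {r γ₀ B M : ℝ} (hγ₀ : 0 < γ₀) (hrem : RunConstRemainder (betaOfRecord₁₃ F 2 θ.toStage13Params) b r γ₀) (hB : ∀ k, b k ≤ B)
    (hps : ∀ (n : ℕ) (gs : ℕ → ℝ), RGEqH n (betaOfRecord₁₃ F 2 θ.toStage13Params) gs → Step.InInterval γ₀ n gs →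
      ∀ k, k ≤ n → -M ≤ ∑ j ∈ Finset.Ico k n, betaOfRecord₁₃ F 2 θ.toStage13Params j (prefixOf gs j)) :
    ∃ (θ : Stage13HParams F 2) (h : θ.Provisos₁₃SepCoPH F 2) (w : WorldP), (θ.ZhUnity F 2 ∧ θ.SlotsNondegenerate₁₃ F 2) ∧ θ.Admissible F 2 ∧
      (∃ (θ' : Stage13HParams F 2) (h' : θ'.Provisos₁₃SepCoPH F 2), θ'.Admissible F 2 ∧
        datumOfRecord₁₃SepCoPH F 2 θ h = datumOfRecord₁₃SepCoPH F 2 θ' h' ∧ w.C = (datumOfRecord₁₃SepCoPH F 2 θ h).C ∧ (0 < w.γ ∧ w.γ ≤ θ'.γ) ∧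
        w.L = (θ'.L : ℝ) ∧ ∀ P : B12.RunParams, w.up P = upOfRecord₅CS F 2 (θ'.toStage5₁₃CoPH F 2) P) ∧
      (∀ P : B12.RunParams, Nodes (leavesP w P)) ∧
      ∃ (b : ℕ → ℝ) (r γ₀ B M : ℝ), 0 < γ₀ ∧ RunConstRemainder (betaOfRecord₁₃ F 2 θ.toStage13Params) b r γ₀ ∧ (∀ k, b k ≤ B) ∧ B + r ≤ w.βup ∧
        ∀ (n : ℕ) (gs : ℕ → ℝ), RGEqH n (betaOfRecord₁₃ F 2 θ.toStage13Params) gs → Step.InInterval γ₀ n gs →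
          ∀ k, k ≤ n → -M ≤ ∑ j ∈ Finset.Ico k n, betaOfRecord₁₃ F 2 θ.toStage13Params j (prefixOf gs j) := by
  obtain ⟨w, hc, hR, hnodes⟩ := hfam (B + r)
  exact ⟨θ, h, w, hU, hθ, hR, hnodes, b, r, γ₀, B, M, hγ₀, hrem, hB, hc, hps⟩

/-- **… hence the REGISTERED v6 STUB 2″'s CONCLUSION at `F` from ONE ∃-side producer «ceiling-keyed rung 1 + match-free run rows at the same tuple»** — the text a K1 re-cut would register
if the ceiling-keyed rung 1 ever becomes stub 1 (plan: «only if a later K1 re-cut is triggered anyway»).  Hypothesis-form; closes nothing. [cite: Balaban1987RG1, Thm 3 p.264; Balaban1989LargeFieldII, Thm 1 p.355 (bookkeeping)] -/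
theorem runRowsText_of_ceilingKeyedRung1WithRows
    (hprod : ∃ (θ : Stage13HParams F 2) (h : θ.Provisos₁₃SepCoPH F 2), (θ.ZhUnity F 2 ∧ θ.SlotsNondegenerate₁₃ F 2) ∧ θ.Admissible F 2 ∧
      (∀ c : ℝ, ∃ w : WorldP, c ≤ w.βup ∧
        (∃ (θ' : Stage13HParams F 2) (h' : θ'.Provisos₁₃SepCoPH F 2), θ'.Admissible F 2 ∧
          datumOfRecord₁₃SepCoPH F 2 θ h = datumOfRecord₁₃SepCoPH F 2 θ' h' ∧ w.C = (datumOfRecord₁₃SepCoPH F 2 θ h).C ∧ (0 < w.γ ∧ w.γ ≤ θ'.γ) ∧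
          w.L = (θ'.L : ℝ) ∧ ∀ P : B12.RunParams, w.up P = upOfRecord₅CS F 2 (θ'.toStage5₁₃CoPH F 2) P) ∧
        (∀ P : B12.RunParams, Nodes (leavesP w P))) ∧
      ∃ (b : ℕ → ℝ) (r γ₀ B M : ℝ), 0 < γ₀ ∧ RunConstRemainder (betaOfRecord₁₃ F 2 θ.toStage13Params) b r γ₀ ∧ (∀ k, b k ≤ B) ∧
        ∀ (n : ℕ) (gs : ℕ → ℝ), RGEqH n (betaOfRecord₁₃ F 2 θ.toStage13Params) gs → Step.InInterval γ₀ n gs →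
          ∀ k, k ≤ n → -M ≤ ∑ j ∈ Finset.Ico k n, betaOfRecord₁₃ F 2 θ.toStage13Params j (prefixOf gs j)) :
    ∃ (θ : Stage13HParams F 2) (h : θ.Provisos₁₃SepCoPH F 2) (w : WorldP), (θ.ZhUnity F 2 ∧ θ.SlotsNondegenerate₁₃ F 2) ∧ θ.Admissible F 2 ∧
      (∃ (θ' : Stage13HParams F 2) (h' : θ'.Provisos₁₃SepCoPH F 2), θ'.Admissible F 2 ∧
        datumOfRecord₁₃SepCoPH F 2 θ h = datumOfRecord₁₃SepCoPH F 2 θ' h' ∧ w.C = (datumOfRecord₁₃SepCoPH F 2 θ h).C ∧ (0 < w.γ ∧ w.γ ≤ θ'.γ) ∧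
        w.L = (θ'.L : ℝ) ∧ ∀ P : B12.RunParams, w.up P = upOfRecord₅CS F 2 (θ'.toStage5₁₃CoPH F 2) P) ∧
      (∀ P : B12.RunParams, Nodes (leavesP w P)) ∧
      ∃ (b : ℕ → ℝ) (r γ₀ B M : ℝ), 0 < γ₀ ∧ RunConstRemainder (betaOfRecord₁₃ F 2 θ.toStage13Params) b r γ₀ ∧ (∀ k, b k ≤ B) ∧ B + r ≤ w.βup ∧
        ∀ (n : ℕ) (gs : ℕ → ℝ), RGEqH n (betaOfRecord₁₃ F 2 θ.toStage13Params) gs → Step.InInterval γ₀ n gs →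
          ∀ k, k ≤ n → -M ≤ ∑ j ∈ Finset.Ico k n, betaOfRecord₁₃ F 2 θ.toStage13Params j (prefixOf gs j) := by
  obtain ⟨θ, h, hU, hθ, hfam, b, r, γ₀, B, M, hγ₀, hrem, hB, hps⟩ := hprod
  exact runRowsText_of_ceilingKeyedRung1_of_rows θ h hU hθ hfam hγ₀ hrem hB hps

end CeilingKeyed

end Summit.QuantumFields.YangMills.BalabanUVNodes.K1RunRowsOfBoxAndPartialSums

end
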